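import Mathlib.Analysis.Calculus.Deriv.Pow
import Mathlib.Analysis.Calculus.Deriv.Mul
import Mathlib.Analysis.Calculus.Deriv.Add
import Mathlib.Algebra.BigOperators.Fin
import Mathlib.Tactic

/-!
# The two double-counting terms of `DFT+U` — «fully localised limit» (FLL) and «around mean field»
# (AMF) —, what each is EXACT on, their potentials, their difference `(U − J)(n̄_σ − ½)`, and the
# `U(½ − n)` level shift of the simplest functional

A `DFT+U` (and, with a solver in place of Hartree–Fock, a `DFT+DMFT`) calculation on a correlated
shell of `d = 2l + 1` orbitals adds `E_Hub − E_dc` to the functional, where the mean-field Hubbard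
energy of the occupations `n_{mσ}` is [HimmetogluEtAl2013, Eq. (38)]
`⟨H_Hub⟩ = ½ Σ_{m m' σ} U n_{mσ} n_{m' σ̄} + ½ Σ*_{m ≠ m', σ} (U − J) n_{mσ} n_{m'σ}`
and the double-counting term `E_dc = ⟨H_Hub⟩_dc` is one of [HimmetogluEtAl2013, Eq. (39)]
`⟨H_Hub⟩^{AMF} = U N_↑ N_↓ + ½ (U − J) (2l/(2l+1)) (N_↑² + N_↓²)`,
`⟨H_Hub⟩^{FLL} = (U/2) N(N − 1) − (J/2) Σ_σ N_σ(N_σ − 1)`,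
`N_σ = Σ_m n_{mσ}`, `N = N_↑ + N_↓`.  Which one a three-band (`d–p`) `DFT+DMFT` study uses moves the
correlated level relative to the ligand level by electron-volts, so the printed charge-transfer
energies `Δ_pd` of cuprates / nickelates differ BY CONSTRUCTION; this file types the exact bookkeeping.

* §1 `hubMF`, `dcFLL`, `dcAMF` as definitions (`d` orbitals per spin, so `2l/(2l+1) = (d−1)/d`).
* §2 what each term is exact on: `hubMF = dcFLL` on every INTEGER (idempotent, `n² = n`) occupation
  pattern («each electron interacts with the other N − 1»), `hubMF = dcAMF` on every spin-wise UNIFORM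
  pattern `n_{mσ} = N_σ/d` (the mean field) [HimmetogluEtAl2013, §V.A].
* §3 the difference `dcFLL − dcAMF = −½(U − J) Σ_σ N_σ(1 − N_σ/d)` (so `FLL ≤ AMF` for `U ≥ J`,
  `0 ≤ N_σ ≤ d`), the potentials `v^{FLL}_σ = U(N − ½) − J(N_σ − ½)` and
  `v^{AMF}_σ = U N_σ̄ + (U − J)((d−1)/d) N_σ` as exact derivatives, and
  `v^{FLL}_σ − v^{AMF}_σ = (U − J)(N_σ/d − ½)`: for a more than half-filled shell the FLL correlated
  level lies deeper by `(U − J)(n̄_σ − ½)` (`d⁹`: `n̄_σ = 0.9` ⇒ `0.4 (U − J)`), the located size of the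
  double-counting lever on `Δ_pd`; the `α`-interpolation `α·FLL + (1−α)·AMF` lies between the two.
* §4 the simplest («Dudarev») functional [HimmetogluEtAl2013, Eq. (2)] with `J = 0`:
  `E_U = (U/2)[Σ_{(mσ)≠(m'σ')} n n' − N(N−1)] = (U/2) Σ_{mσ} n_{mσ}(1 − n_{mσ})`, whose orbital potential
  is `U(½ − n_{mσ})` [HimmetogluEtAl2013, Eq. (4)]: an occupied localized level moves down by `U/2`, an
  empty one up by `U/2`, their separation opens by exactly `U`.
* §5 the FLL term «extended straightforwardly to the dp basis» of a three-band (Emery) `DFT+DMFT`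
  [HansmannEtAl2014, Eq. (2)]: `Δε_d^{DC} = U_dd(n_d − ½) + 4 U_pd n_p`, `Δε_p^{DC} = U_pp(n_p − ½) + 2 U_pd n_d`
  (four O neighbours of Cu, two Cu neighbours of O) — «a relative shift between the d- and p-states»: its
  `U_dd` part is `v^{FLL}` at `J = 0`, the RELATIVE shift in closed form, and the printed remark that at
  unchanged densities the `U_pd` part of the DC cancels the Hartree field of `U_pd` exactly.

Pure algebra/calculus on real occupations; everything PROVED, no facts, no `sorry`.  NOT here:
rotationally invariant (Liechtenstein) functionals with full `U_{mm'm''m'''}`, the `+U` functional's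
effect on Kohn–Sham bands beyond the potential formula, any statement about which flavour is right
for a material, DMFT «exact»/«nominal» double countings.

References: B. Himmetoglu, A. Floris, S. de Gironcoli, M. Cococcioni, Int. J. Quantum Chem. 114 (2014)
14, arXiv:1309.3355, Eqs. (2), (4), (36)–(39) and §V.A (held text p0003, p0019), reporting
Anisimov et al. 1991/1993 (FLL), Czyżyk–Sawatzky 1994 (AMF) and Petukhov et al. 2003 (mixing);
P. Hansmann, N. Parragh, A. Toschi, G. Sangiovanni, K. Held, New J. Phys. 16 (2014) 033009,
arXiv:1312.2757, Eq. (2) (held text p0006–p0007).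
AI-produced formalisation (H21, cell hubbard-downfold, seat lit-1, 2026-08-27).
-/

noncomputable section

open Finset
open scoped BigOperators

namespace Literature.MathematicalPhysics.QuantumLattice

namespace DoubleCounting

variable {d : ℕ}

/-! ## 1. The mean-field Hubbard energy and the two double-counting terms -/

/-- Spin-resolved shell occupation `N_σ = Σ_m n_{mσ}`. [cite: HimmetogluEtAl2013, Eq. (39)] -/
def Nspin (n : Fin d → Fin 2 → ℝ) (σ : Fin 2) : ℝ := ∑ m, n m σ

/-- Mean-field Hubbard energy of an occupation pattern,
`½ Σ_{m m' σ} U n_{mσ} n_{m'σ̄} + ½ Σ_{m ≠ m', σ} (U − J) n_{mσ} n_{m'σ}` (`σ̄ = Fin.rev σ`).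
[cite: HimmetogluEtAl2013, Eq. (38)] -/
def hubMF (U J : ℝ) (n : Fin d → Fin 2 → ℝ) : ℝ :=
  1 / 2 * ∑ σ, ∑ m, ∑ m', U * n m σ * n m' σ.rev
    + 1 / 2 * ∑ σ, ∑ m, ∑ m', (if m = m' then 0 else (U - J) * n m σ * n m' σ)

/-- The «fully localised limit» double counting `(U/2) N(N−1) − (J/2) Σ_σ N_σ(N_σ−1)`.
[cite: HimmetogluEtAl2013, Eq. (39)] -/
def dcFLL (U J Nu Nd : ℝ) : ℝ :=
  U / 2 * (Nu + Nd) * (Nu + Nd - 1) - J / 2 * (Nu * (Nu - 1) + Nd * (Nd - 1))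

/-- The «around mean field» double counting `U N_↑N_↓ + ½(U−J)(2l/(2l+1))(N_↑² + N_↓²)`, written with
`d = 2l+1` orbitals: `2l/(2l+1) = (d−1)/d`. [cite: HimmetogluEtAl2013, Eq. (39)] -/
def dcAMF (U J : ℝ) (d : ℕ) (Nu Nd : ℝ) : ℝ :=
  U * Nu * Nd + 1 / 2 * (U - J) * (((d : ℝ) - 1) / d) * (Nu ^ 2 + Nd ^ 2)

/-- Plumbing: the off-diagonal double sum `Σ_{m ≠ m'} a_m a_{m'} = (Σ a)² − Σ a²`. [cite: HimmetogluEtAl2013, Eq. (38)] -/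
theorem sum_offDiag (a : Fin d → ℝ) :
    ∑ m, ∑ m', (if m = m' then 0 else a m * a m') = (∑ m, a m) ^ 2 - ∑ m, a m ^ 2 := by
  have h : ∀ m m' : Fin d, (if m = m' then 0 else a m * a m') =
      a m * a m' - (if m = m' then a m * a m' else 0) := by
    intro m m'; split_ifs <;> ring
  simp_rw [h, sum_sub_distrib, sum_ite_eq, if_pos (mem_univ _)]
  rw [sq, sum_mul_sum]
  simp_rw [sq]

/-- The opposite-spin part summed: `Σ_σ N_σ N_σ̄ = 2 N_↑ N_↓`. [cite: HimmetogluEtAl2013, Eq. (38)] -/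
theorem sum_Nspin_mul_rev (n : Fin d → Fin 2 → ℝ) :
    ∑ σ, Nspin n σ * Nspin n σ.rev = 2 * (Nspin n 0 * Nspin n 1) := by
  rw [Fin.sum_univ_two]
  have h0 : (0 : Fin 2).rev = 1 := rfl
  have h1 : (1 : Fin 2).rev = 0 := rfl
  rw [h0, h1]; ring

/-- `hubMF` in shell variables: `U N_↑N_↓ + ½(U−J) Σ_σ (N_σ² − Σ_m n_{mσ}²)`. [cite: HimmetogluEtAl2013, Eq. (38)] -/
theorem hubMF_eq (U J : ℝ) (n : Fin d → Fin 2 → ℝ) :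
    hubMF U J n = U * (Nspin n 0 * Nspin n 1)
      + 1 / 2 * (U - J) * ∑ σ, (Nspin n σ ^ 2 - ∑ m, n m σ ^ 2) := by
  unfold hubMF
  have hA : ∀ σ : Fin 2, ∑ m, ∑ m', U * n m σ * n m' σ.rev = U * (Nspin n σ * Nspin n σ.rev) := by
    intro σ
    simp_rw [mul_assoc, ← mul_sum, ← sum_mul]
    rfl
  have hB : ∀ σ : Fin 2, ∑ m, ∑ m', (if m = m' then 0 else (U - J) * n m σ * n m' σ) =
      (U - J) * (Nspin n σ ^ 2 - ∑ m, n m σ ^ 2) := by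
    intro σ
    have := sum_offDiag (fun m => n m σ)
    have h2 : ∀ m m' : Fin d, (if m = m' then 0 else (U - J) * n m σ * n m' σ) =
        (U - J) * (if m = m' then 0 else n m σ * n m' σ) := by
      intro m m'; split_ifs <;> ring
    simp_rw [h2, ← mul_sum, this]
    rfl
  simp_rw [hA, hB, ← mul_sum, sum_Nspin_mul_rev]
  ring

/-! ## 2. What each double counting is exact on -/

/-- **FLL is exact on integer occupations**: if every `n_{mσ} ∈ {0,1}` (idempotent, `n² = n`), the
mean-field Hubbard energy IS the FLL term. [cite: HimmetogluEtAl2013, §V.A] -/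
theorem hubMF_eq_dcFLL_of_idempotent (U J : ℝ) {n : Fin d → Fin 2 → ℝ}
    (hn : ∀ m σ, n m σ ^ 2 = n m σ) :
    hubMF U J n = dcFLL U J (Nspin n 0) (Nspin n 1) := by
  rw [hubMF_eq, dcFLL]
  have hsq : ∀ σ : Fin 2, ∑ m, n m σ ^ 2 = Nspin n σ := by
    intro σ; unfold Nspin; exact sum_congr rfl fun m _ => hn m σ
  simp_rw [hsq, Fin.sum_univ_two]
  ring

/-- **AMF is exact on uniform occupations**: if `n_{mσ} = c_σ` for all `m` (the spin-wise mean field),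
the mean-field Hubbard energy IS the AMF term (`d ≠ 0`). [cite: HimmetogluEtAl2013, §V.A] -/
theorem hubMF_eq_dcAMF_of_uniform (U J : ℝ) (hd : d ≠ 0) {n : Fin d → Fin 2 → ℝ} {c : Fin 2 → ℝ}
    (hn : ∀ m σ, n m σ = c σ) :
    hubMF U J n = dcAMF U J d (Nspin n 0) (Nspin n 1) := by
  rw [hubMF_eq, dcAMF]
  have hN : ∀ σ : Fin 2, Nspin n σ = d * c σ := by
    intro σ; unfold Nspin; simp_rw [hn]; rw [sum_const, card_univ, Fintype.card_fin, nsmul_eq_mul]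
  have hsq : ∀ σ : Fin 2, ∑ m, n m σ ^ 2 = d * c σ ^ 2 := by
    intro σ; simp_rw [hn]; rw [sum_const, card_univ, Fintype.card_fin, nsmul_eq_mul]
  simp_rw [hsq, Fin.sum_univ_two, hN]
  have hd' : (d : ℝ) ≠ 0 := Nat.cast_ne_zero.mpr hd
  have key : (((d : ℝ) - 1) / d) * ((d * c 0) ^ 2 + (d * c 1) ^ 2)
      = (d * c 0) ^ 2 - d * c 0 ^ 2 + ((d * c 1) ^ 2 - d * c 1 ^ 2) := by
    rw [div_mul_eq_mul_div, div_eq_iff hd']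
    ring
  rw [← key]
  ring

/-! ## 3. FLL against AMF: the difference, the potentials, the level lever -/

/-- `dcFLL − dcAMF = −½(U − J) Σ_σ N_σ (1 − N_σ/d)` (`d ≠ 0`). [cite: HimmetogluEtAl2013, Eq. (39)] -/
theorem dcFLL_sub_dcAMF (U J : ℝ) (hd : d ≠ 0) (Nu Nd : ℝ) :
    dcFLL U J Nu Nd - dcAMF U J d Nu Nd =
      -(1 / 2 * (U - J) * (Nu * (1 - Nu / d) + Nd * (1 - Nd / d))) := by
  have hd' : (d : ℝ) ≠ 0 := Nat.cast_ne_zero.mpr hd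
  rw [dcFLL, dcAMF]
  field_simp
  ring

/-- Hence `dcFLL ≤ dcAMF` whenever `J ≤ U` and the shell occupations are physical, `0 ≤ N_σ ≤ d`.
[cite: HimmetogluEtAl2013, §V.A] -/
theorem dcFLL_le_dcAMF {U J : ℝ} (hUJ : J ≤ U) (hd : d ≠ 0) {Nu Nd : ℝ}
    (hu0 : 0 ≤ Nu) (hu1 : Nu ≤ d) (hd0 : 0 ≤ Nd) (hd1 : Nd ≤ d) :
    dcFLL U J Nu Nd ≤ dcAMF U J d Nu Nd := by
  have hdpos : (0 : ℝ) < d := Nat.cast_pos.mpr (Nat.pos_of_ne_zero hd)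
  have h := dcFLL_sub_dcAMF U J hd Nu Nd
  have hu : 0 ≤ Nu * (1 - Nu / d) := mul_nonneg hu0 (by rw [sub_nonneg, div_le_one hdpos]; exact hu1)
  have hdd : 0 ≤ Nd * (1 - Nd / d) := mul_nonneg hd0 (by rw [sub_nonneg, div_le_one hdpos]; exact hd1)
  nlinarith

/-- The FLL potential on spin `σ`: `v^{FLL}_σ = U(N − ½) − J(N_σ − ½)`. [cite: HimmetogluEtAl2013, Eq. (39)] -/
def vFLL (U J N Nσ : ℝ) : ℝ := U * (N - 1 / 2) - J * (Nσ - 1 / 2)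

/-- The AMF potential on spin `σ`: `v^{AMF}_σ = U N_σ̄ + (U − J)((d−1)/d) N_σ`. [cite: HimmetogluEtAl2013, Eq. (39)] -/
def vAMF (U J : ℝ) (d : ℕ) (Nσ Nσ' : ℝ) : ℝ := U * Nσ' + (U - J) * (((d : ℝ) - 1) / d) * Nσ

/-- `v^{FLL}_↑` IS the derivative of `dcFLL` in `N_↑` at fixed `N_↓`. [cite: HimmetogluEtAl2013, Eq. (39)] -/
theorem hasDerivAt_dcFLL (U J Nu Nd : ℝ) :
    HasDerivAt (fun x => dcFLL U J x Nd) (vFLL U J (Nu + Nd) Nu) Nu := by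
  have hx : HasDerivAt (fun x : ℝ => x) 1 Nu := hasDerivAt_id' Nu
  have hA : HasDerivAt (fun x : ℝ => U / 2 * (x + Nd) * (x + Nd - 1))
      (U / 2 * 1 * (Nu + Nd - 1) + U / 2 * (Nu + Nd) * 1) Nu :=
    ((hx.add_const Nd).const_mul (U / 2)).mul ((hx.add_const Nd).sub_const 1)
  have hB : HasDerivAt (fun x : ℝ => J / 2 * (x * (x - 1) + Nd * (Nd - 1)))
      (J / 2 * (1 * (Nu - 1) + Nu * 1)) Nu :=
    ((hx.mul (hx.sub_const 1)).add_const (Nd * (Nd - 1))).const_mul (J / 2)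
  exact (hA.sub hB).congr_deriv (by simp only [vFLL]; ring)

/-- `v^{AMF}_↑` IS the derivative of `dcAMF` in `N_↑` at fixed `N_↓`. [cite: HimmetogluEtAl2013, Eq. (39)] -/
theorem hasDerivAt_dcAMF (U J : ℝ) (d : ℕ) (Nu Nd : ℝ) :
    HasDerivAt (fun x => dcAMF U J d x Nd) (vAMF U J d Nu Nd) Nu := by
  have hx : HasDerivAt (fun x : ℝ => x) 1 Nu := hasDerivAt_id' Nu
  have h1 : HasDerivAt (fun x : ℝ => U * x * Nd) (U * 1 * Nd) Nu := (hx.const_mul U).mul_const Nd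
  have h2 : HasDerivAt (fun x : ℝ => x ^ 2 + Nd ^ 2) (2 * Nu) Nu := by
    simpa using (hasDerivAt_pow 2 Nu).add_const (Nd ^ 2)
  have h3 : HasDerivAt (fun x : ℝ => 1 / 2 * (U - J) * (((d : ℝ) - 1) / d) * (x ^ 2 + Nd ^ 2))
      (1 / 2 * (U - J) * (((d : ℝ) - 1) / d) * (2 * Nu)) Nu :=
    h2.const_mul (1 / 2 * (U - J) * (((d : ℝ) - 1) / d))
  exact (h1.add h3).congr_deriv (by simp only [vAMF]; ring)

/-- **The double-counting lever on the correlated level**: `v^{FLL}_σ − v^{AMF}_σ = (U − J)(N_σ/d − ½)`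
(`d ≠ 0`; `N = N_σ + N_σ̄`). For a more than half-filled shell (`N_σ/d > ½`) the FLL potential is the
larger, i.e. the FLL correlated level lies DEEPER by `(U − J)(n̄_σ − ½)`. [cite: HimmetogluEtAl2013, §V.A] -/
theorem vFLL_sub_vAMF (U J : ℝ) (hd : d ≠ 0) (Nσ Nσ' : ℝ) :
    vFLL U J (Nσ + Nσ') Nσ - vAMF U J d Nσ Nσ' = (U - J) * (Nσ / d - 1 / 2) := by
  have hd' : (d : ℝ) ≠ 0 := Nat.cast_ne_zero.mpr hd
  rw [vFLL, vAMF]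
  field_simp
  ring

/-- At exactly half filling per spin (`N_σ = d/2`) the two potentials coincide. [cite: HimmetogluEtAl2013, §V.A] -/
theorem vFLL_eq_vAMF_of_half (U J : ℝ) (hd : d ≠ 0) (Nσ' : ℝ) :
    vFLL U J ((d : ℝ) / 2 + Nσ') ((d : ℝ) / 2) = vAMF U J d ((d : ℝ) / 2) Nσ' := by
  have h := vFLL_sub_vAMF U J hd ((d : ℝ) / 2) Nσ'
  have hd' : (d : ℝ) ≠ 0 := Nat.cast_ne_zero.mpr hd
  have : ((d : ℝ) / 2) / d - 1 / 2 = 0 := by field_simp; ring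
  rw [this, mul_zero, sub_eq_zero] at h
  exact h

/-- The `α`-interpolated double counting `α·FLL + (1 − α)·AMF` (Petukhov et al. 2003, as reported).
[cite: HimmetogluEtAl2013, §V.A] -/
def dcMix (α U J : ℝ) (d : ℕ) (Nu Nd : ℝ) : ℝ := α * dcFLL U J Nu Nd + (1 - α) * dcAMF U J d Nu Nd

/-- For `0 ≤ α ≤ 1` (and `FLL ≤ AMF`) the interpolated term lies between the two flavours.
[cite: HimmetogluEtAl2013, §V.A] -/
theorem dcMix_mem_Icc {α U J : ℝ} (hα0 : 0 ≤ α) (hα1 : α ≤ 1) {Nu Nd : ℝ}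
    (h : dcFLL U J Nu Nd ≤ dcAMF U J d Nu Nd) :
    dcMix α U J d Nu Nd ∈ Set.Icc (dcFLL U J Nu Nd) (dcAMF U J d Nu Nd) := by
  rw [dcMix, Set.mem_Icc]
  constructor <;> nlinarith

/-! ## 4. The simplest functional (`J = 0`): `E_U = (U/2) Σ n(1 − n)` and the `U(½ − n)` level shift -/

/-- The simplest FLL corrective functional on one shell, `J = 0`, occupations indexed by any finite
type of spin-orbitals: `E_U = (U/2)[Σ_{i ≠ j} n_i n_j − N(N − 1)]`. [cite: HimmetogluEtAl2013, Eq. (2)] -/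
def eU {ι : Type*} [Fintype ι] [DecidableEq ι] (U : ℝ) (n : ι → ℝ) : ℝ :=
  U / 2 * (∑ i, ∑ j, (if i = j then 0 else n i * n j)) - U / 2 * ((∑ i, n i) * (∑ i, n i - 1))

/-- `E_U = (U/2) Σ_i n_i (1 − n_i)` — the penalty on non-integer occupations. [cite: HimmetogluEtAl2013, Eq. (2)] -/
theorem eU_eq {ι : Type*} [Fintype ι] [DecidableEq ι] (U : ℝ) (n : ι → ℝ) :
    eU U n = U / 2 * ∑ i, n i * (1 - n i) := by
  have h : ∀ i j : ι, (if i = j then 0 else n i * n j) = n i * n j - (if i = j then n i * n j else 0) := by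
    intro i j; split_ifs <;> ring
  unfold eU
  simp_rw [h, sum_sub_distrib, sum_ite_eq, if_pos (mem_univ _), ← sum_mul_sum, mul_sub, mul_one]
  rw [sum_sub_distrib]
  ring

/-- `E_U` vanishes on integer occupation patterns (`n_i² = n_i`). [cite: HimmetogluEtAl2013, Eq. (2)] -/
theorem eU_eq_zero_of_idempotent {ι : Type*} [Fintype ι] [DecidableEq ι] (U : ℝ) {n : ι → ℝ}
    (hn : ∀ i, n i ^ 2 = n i) : eU U n = 0 := by
  rw [eU_eq]
  have : ∀ i, n i * (1 - n i) = 0 := by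
    intro i; have := hn i; rw [sq] at this; linear_combination (-1 : ℝ) * this
  simp [this]

/-- `E_U ≥ 0` on physical occupations `0 ≤ n_i ≤ 1` when `U ≥ 0`. [cite: HimmetogluEtAl2013, Eq. (2)] -/
theorem eU_nonneg {ι : Type*} [Fintype ι] [DecidableEq ι] {U : ℝ} (hU : 0 ≤ U) {n : ι → ℝ}
    (h0 : ∀ i, 0 ≤ n i) (h1 : ∀ i, n i ≤ 1) : 0 ≤ eU U n := by
  rw [eU_eq]
  exact mul_nonneg (by positivity) (sum_nonneg fun i _ => mul_nonneg (h0 i) (by linarith [h1 i]))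

/-- The single-orbital summand `(U/2) x(1 − x)` has derivative `U(½ − x)`: the «+U» potential is
repulsive below and attractive above half occupation. [cite: HimmetogluEtAl2013, Eq. (4)] -/
theorem hasDerivAt_eU_summand (U x : ℝ) :
    HasDerivAt (fun y : ℝ => U / 2 * (y * (1 - y))) (U * (1 / 2 - x)) x := by
  have hx : HasDerivAt (fun y : ℝ => y) 1 x := hasDerivAt_id' x
  have h1 : HasDerivAt (fun y : ℝ => 1 - y) (-1) x := by simpa using hx.const_sub 1
  exact ((hx.mul h1).const_mul (U / 2)).congr_deriv (by ring)

/-- The printed orbital potential `U(½ − n)`. [cite: HimmetogluEtAl2013, Eq. (4)] -/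
def vU (U n : ℝ) : ℝ := U * (1 / 2 - n)

/-- An occupied localized level is pushed DOWN by `U/2`, an empty one UP by `U/2`, and their
separation opens by exactly `U`. [cite: HimmetogluEtAl2013, Eq. (4)] -/
theorem vU_levels (U : ℝ) : vU U 1 = -(U / 2) ∧ vU U 0 = U / 2 ∧ vU U 0 - vU U 1 = U := by
  simp only [vU]; refine ⟨by ring, by ring, by ring⟩

/-- The potential is affine and decreasing in the occupation: `vU U n − vU U n' = −U (n − n')`.
[cite: HimmetogluEtAl2013, Eq. (4)] -/
theorem vU_sub (U n n' : ℝ) : vU U n - vU U n' = -(U * (n - n')) := by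
  simp only [vU]; ring

/-! ## 5. The FLL double counting extended to the `d–p` basis (three-band `DFT+DMFT`) -/

/-- The copper-level double-counting shift of the dp-extended FLL: `Δε_d^{DC} = U_dd(n_d − ½) + 4 U_pd n_p`
(four oxygen neighbours). [cite: HansmannEtAl2014, Eq. (2)] -/
def dcShiftD (Udd Upd nd np : ℝ) : ℝ := Udd * (nd - 1 / 2) + 4 * Upd * np

/-- The oxygen-level double-counting shift of the dp-extended FLL: `Δε_p^{DC} = U_pp(n_p − ½) + 2 U_pd n_d`
(two copper neighbours). [cite: HansmannEtAl2014, Eq. (2)] -/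
def dcShiftP (Upp Upd nd np : ℝ) : ℝ := Upp * (np - 1 / 2) + 2 * Upd * nd

/-- The on-site part of the copper shift IS the FLL potential at `J = 0` (with `N = N_σ = n_d` as printed).
[cite: HansmannEtAl2014, Eq. (2)] -/
theorem dcShiftD_eq_vFLL (Udd nd np : ℝ) : dcShiftD Udd 0 nd np = vFLL Udd 0 nd nd := by
  simp only [dcShiftD, vFLL]; ring

/-- **The RELATIVE d–p shift** («the DC corresponds to a relative shift between the d- and p-states»):
`Δε_d^{DC} − Δε_p^{DC} = U_dd(n_d − ½) − U_pp(n_p − ½) + U_pd(4n_p − 2n_d)` — the amount by which this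
construction moves the bare charge-transfer energy before the solver acts. [cite: HansmannEtAl2014, Eq. (2)] -/
theorem dcShiftD_sub_dcShiftP (Udd Upp Upd nd np : ℝ) :
    dcShiftD Udd Upd nd np - dcShiftP Upp Upd nd np =
      Udd * (nd - 1 / 2) - Upp * (np - 1 / 2) + Upd * (4 * np - 2 * nd) := by
  simp only [dcShiftD, dcShiftP]; ring

/-- The inter-site Hartree field of `U_pd` on the copper level from four oxygens at density `n_p`:
`4 U_pd n_p`; «if n_{d(p)} remained at its LDA value the DC term would cancel the effect of U_pd in
DMFT+Hartree exactly» — the `U_pd` parts of shift and field coincide, on both sublattices.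
[cite: HansmannEtAl2014, Eq. (2)] -/
theorem dcShift_sub_hartree (Udd Upp Upd nd np : ℝ) :
    dcShiftD Udd Upd nd np - 4 * Upd * np = Udd * (nd - 1 / 2) ∧
      dcShiftP Upp Upd nd np - 2 * Upd * nd = Upp * (np - 1 / 2) := by
  simp only [dcShiftD, dcShiftP]; constructor <;> ring

/-- If the solver moves the densities from `(n_d, n_p)` to `(n_d', n_p')` while the DC stays at the reference
densities, the NET `U_pd` level shift on copper is `4 U_pd (n_p' − n_p)` (and `2 U_pd (n_d' − n_d)` on
oxygen): only the density CHANGE acts — «due to the electronic correlations … n_d is reduced and n_p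
enhanced». [cite: HansmannEtAl2014, Eq. (2)] -/
theorem net_Upd_shift (Udd Upp Upd nd np nd' np' : ℝ) :
    4 * Upd * np' - (dcShiftD Udd Upd nd np - Udd * (nd - 1 / 2)) = 4 * Upd * (np' - np) ∧
      2 * Upd * nd' - (dcShiftP Upp Upd nd np - Upp * (np - 1 / 2)) = 2 * Upd * (nd' - nd) := by
  simp only [dcShiftD, dcShiftP]; constructor <;> ring

end DoubleCounting

end Literature.MathematicalPhysics.QuantumLattice

end
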